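import Mathlib
import Summits.ValiantsHypothesis.ValiantsHypothesis.Theorems.DivisionGapPerMultiplesHardStubFaceDescent

/-!
# `DivisionGap.PerMultiplesHard` (stmt-ValiantsHypothesis-5068), line `typed-parse-tree-weights`:
pushing the permanent off a monomial cofactor (rung of the open core `stub_hybridDescent`)

For a face `G ⊆ [n]²` and an exponent `u`, write `per_G = Σ_{σ ⊆ G} x^{μ_σ}` for the face permanent
and `G' := {e ∈ G : e ∉ supp u}`.  If `G'` still contains a perfect matching then

  `L⁺(per_{G'}) ≤ L⁺(x^u · per_G)`                                    (`complexity_pushOff_le`)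

for the tree's monotone fan-in-two `complexity` over `ℝ≥0`: a monomial cofactor whose support leaves a
perfect matching in the face is stripped EXACTLY (no polynomial loss, unlike Jukna–Seiwert–Sergeev
contraction), at the price of passing to the sub-face `G'`.  With `FaceDescent.stub_faceDescent`
(`L⁺(x^u · per_G) ≤ L⁺(per_n · h) + 1` whenever a weight cuts out `G` and isolates the `G`-part `u` of
the multiplier) this is the "isolate-and-push" exit (i)/(iii) of `stub_hybridDescent`: every such `h` with
`G'` rich is as hard as the rich face permanent `per_{G'}`.  The special case `u = 0` is support
avoidance: if the monomials of `h` avoid a graph with a perfect matching, `per_n · h` is as hard as that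
face permanent.

Mechanism.  With the weight `w = 1_{(supp u)ᶜ}` the `w`-weight of `x^{μ_σ}` is `#{i : (σ i, i) ∉ supp u}`,
so the top `w`-component of `per_G` is `per_{G'}` as soon as some `σ ⊆ G` avoids `supp u`
(`topComponent_facePer_eq`); top components are free and multiplicative over `ℝ≥0`
(`complexity_topComponent_le`, `topComponent_mul`), so `L⁺(x^u · per_{G'}) ≤ L⁺(x^u · per_G)`; finally the
projection `x_e ↦ 1` (`e ∈ supp u`), `x_e ↦ x_e` otherwise, kills `x^u` and fixes `per_{G'}`, and
projections are free (`IsProjection.complexity_le_holds`).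
-/

noncomputable section

set_option linter.dupNamespace false

open MvPolynomial Literature.Computability.AlgebraicComplexity
open scoped NNReal BigOperators
open Summit.ValiantsHypothesis.ValiantsHypothesis.Theorems.ZeroOneTransfer.Negative
open Summit.ValiantsHypothesis.ValiantsHypothesis.Theorems.DivisionGap.PerMultiplesHard.FaceDescent

namespace Summit.ValiantsHypothesis.ValiantsHypothesis.Theorems.DivisionGap.PerMultiplesHard.PushOff

variable {n : ℕ}

/-- Coefficients of the face permanent: `1` on permutation monomials inside `G`, `0` elsewhere.
[folklore] -/
theorem coeff_facePer (G : Finset (Fin n × Fin n)) (d : (Fin n × Fin n) →₀ ℕ) :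
    coeff d ((∑ σ ∈ (Finset.univ : Finset (Equiv.Perm (Fin n))).filter (fun σ => ∀ i, (σ i, i) ∈ G),
        monomial (permMonomial σ) (1 : ℝ≥0))) =
      if ∃ σ : Equiv.Perm (Fin n), (∀ i, (σ i, i) ∈ G) ∧ permMonomial σ = d then 1 else 0 := by
  classical
  rw [coeff_sum]
  simp only [coeff_monomial]
  by_cases h : ∃ σ : Equiv.Perm (Fin n), (∀ i, (σ i, i) ∈ G) ∧ permMonomial σ = d
  · obtain ⟨σ, hσG, rfl⟩ := h
    rw [if_pos ⟨σ, hσG, rfl⟩, Finset.sum_eq_single σ]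
    · rw [if_pos rfl]
    · intro τ _ hτ
      rw [if_neg (permMonomial_injective.ne hτ)]
    · intro hσ
      exact absurd (Finset.mem_filter.2 ⟨Finset.mem_univ σ, hσG⟩) hσ
  · rw [if_neg h]
    refine Finset.sum_eq_zero fun τ hτ => ?_
    rw [if_neg]
    intro hτd
    exact h ⟨τ, (Finset.mem_filter.1 hτ).2, hτd⟩

/-- Support of the face permanent. [folklore] -/
theorem mem_support_facePer {G : Finset (Fin n × Fin n)} {d : (Fin n × Fin n) →₀ ℕ} :
    d ∈ ((∑ σ ∈ (Finset.univ : Finset (Equiv.Perm (Fin n))).filter (fun σ => ∀ i, (σ i, i) ∈ G),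
        monomial (permMonomial σ) (1 : ℝ≥0))).support ↔ ∃ σ : Equiv.Perm (Fin n), (∀ i, (σ i, i) ∈ G) ∧ permMonomial σ = d := by
  rw [mem_support_iff, coeff_facePer]
  constructor
  · intro h
    by_contra hne
    exact h (if_neg hne)
  · intro h
    rw [if_pos h]
    exact one_ne_zero

/-- The avoidance weight of a permutation monomial is at most `n`. [folklore] -/
theorem weight_avoid_permMonomial_le (u : (Fin n × Fin n) →₀ ℕ) (σ : Equiv.Perm (Fin n)) :
    Finsupp.weight ((fun e : Fin n × Fin n => if e ∈ u.support then (0 : ℕ) else 1)) (permMonomial σ) ≤ n := by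
  rw [weight_permMonomial]
  calc ∑ i, (fun e : Fin n × Fin n => if e ∈ u.support then (0 : ℕ) else 1) (σ i, i) ≤ ∑ _i : Fin n, 1 :=
        Finset.sum_le_sum fun i _ => by simp only []; split_ifs <;> omega
    _ = n := by simp

/-- The avoidance weight of a permutation monomial is `n` iff the permutation avoids `supp u`.
[folklore] -/
theorem weight_avoid_permMonomial_eq_iff (u : (Fin n × Fin n) →₀ ℕ) (σ : Equiv.Perm (Fin n)) :
    Finsupp.weight ((fun e : Fin n × Fin n => if e ∈ u.support then (0 : ℕ) else 1)) (permMonomial σ) = n ↔ ∀ i, (σ i, i) ∉ u.support := by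
  rw [weight_permMonomial]
  constructor
  · intro h i hi
    have hlt : ∑ j, (fun e : Fin n × Fin n => if e ∈ u.support then (0 : ℕ) else 1) (σ j, j) <
        ∑ _j : Fin n, (1 : ℕ) := by
      refine Finset.sum_lt_sum (fun j _ => by simp only []; split_ifs <;> omega)
        ⟨i, Finset.mem_univ i, ?_⟩
      simp only []
      rw [if_pos hi]
      exact zero_lt_one
    rw [h] at hlt
    simp at hlt
  · intro h
    calc ∑ i, (fun e : Fin n × Fin n => if e ∈ u.support then (0 : ℕ) else 1) (σ i, i) = ∑ _i : Fin n, 1 :=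
          Finset.sum_congr rfl fun i _ => by simp only []; rw [if_neg (h i)]
      _ = n := by simp

/-- If some permutation inside `G` avoids `supp u`, the top avoidance-weight of `per_G` is `n`.
[folklore] -/
theorem weightedTotalDegree_facePer (G : Finset (Fin n × Fin n)) (u : (Fin n × Fin n) →₀ ℕ)
    (hex : ∃ σ : Equiv.Perm (Fin n), ∀ i, (σ i, i) ∈ G ∧ (σ i, i) ∉ u.support) :
    weightedTotalDegree ((fun e : Fin n × Fin n => if e ∈ u.support then (0 : ℕ) else 1)) ((∑ σ ∈ (Finset.univ : Finset (Equiv.Perm (Fin n))).filter (fun σ => ∀ i, (σ i, i) ∈ G),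
        monomial (permMonomial σ) (1 : ℝ≥0))) = n := by
  obtain ⟨σ, hσ⟩ := hex
  refine le_antisymm (Finset.sup_le fun d hd => ?_) ?_
  · obtain ⟨τ, -, rfl⟩ := mem_support_facePer.1 hd
    exact weight_avoid_permMonomial_le u τ
  · have hmem : permMonomial σ ∈ ((∑ σ ∈ (Finset.univ : Finset (Equiv.Perm (Fin n))).filter (fun σ => ∀ i, (σ i, i) ∈ G),
        monomial (permMonomial σ) (1 : ℝ≥0))).support :=
      mem_support_facePer.2 ⟨σ, fun i => (hσ i).1, rfl⟩
    have h := le_weightedTotalDegree ((fun e : Fin n × Fin n => if e ∈ u.support then (0 : ℕ) else 1)) hmem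
    rwa [(weight_avoid_permMonomial_eq_iff u σ).2 fun i => (hσ i).2] at h

/-- **The top avoidance-component of a face permanent is the sub-face permanent.**  If some
permutation inside `G` avoids `supp u`, then `top_w per_G = per_{G'}` for `w = 1_{(supp u)ᶜ}` and
`G' = {e ∈ G : e ∉ supp u}`. [folklore] -/
theorem topComponent_facePer_eq (G : Finset (Fin n × Fin n)) (u : (Fin n × Fin n) →₀ ℕ)
    (hex : ∃ σ : Equiv.Perm (Fin n), ∀ i, (σ i, i) ∈ G ∧ (σ i, i) ∉ u.support) :
    topComponent ((fun e : Fin n × Fin n => if e ∈ u.support then (0 : ℕ) else 1)) ((∑ σ ∈ (Finset.univ : Finset (Equiv.Perm (Fin n))).filter (fun σ => ∀ i, (σ i, i) ∈ G),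
        monomial (permMonomial σ) (1 : ℝ≥0))) = (∑ σ ∈ (Finset.univ : Finset (Equiv.Perm (Fin n))).filter (fun σ => ∀ i, (σ i, i) ∈ (G.filter fun e => e ∉ u.support)),
        monomial (permMonomial σ) (1 : ℝ≥0)) := by
  classical
  refine MvPolynomial.ext _ _ fun d => ?_
  rw [coeff_topComponent, weightedTotalDegree_facePer G u hex, coeff_facePer, coeff_facePer]
  by_cases hd : ∃ σ : Equiv.Perm (Fin n), (∀ i, (σ i, i) ∈ G) ∧ permMonomial σ = d
  · obtain ⟨σ, hσG, rfl⟩ := hd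
    have hinG : ∃ σ' : Equiv.Perm (Fin n), (∀ i, (σ' i, i) ∈ G) ∧ permMonomial σ' = permMonomial σ :=
      ⟨σ, hσG, rfl⟩
    by_cases hav : ∀ i, (σ i, i) ∉ u.support
    · have hinG' : ∃ σ' : Equiv.Perm (Fin n),
          (∀ i, (σ' i, i) ∈ G.filter fun e => e ∉ u.support) ∧ permMonomial σ' = permMonomial σ :=
        ⟨σ, fun i => Finset.mem_filter.2 ⟨hσG i, hav i⟩, rfl⟩
      rw [if_pos ((weight_avoid_permMonomial_eq_iff u σ).2 hav), if_pos hinG, if_pos hinG']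
    · have hninG' : ¬ ∃ σ' : Equiv.Perm (Fin n),
          (∀ i, (σ' i, i) ∈ G.filter fun e => e ∉ u.support) ∧ permMonomial σ' = permMonomial σ := by
        rintro ⟨τ, hτ, hτσ⟩
        obtain rfl : τ = σ := permMonomial_injective hτσ
        exact hav fun i => (Finset.mem_filter.1 (hτ i)).2
      rw [if_neg (fun h => hav ((weight_avoid_permMonomial_eq_iff u σ).1 h)), if_neg hninG']
  · have hninG' : ¬ ∃ σ' : Equiv.Perm (Fin n),
        (∀ i, (σ' i, i) ∈ G.filter fun e => e ∉ u.support) ∧ permMonomial σ' = d := by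
      rintro ⟨τ, hτ, rfl⟩
      exact hd ⟨τ, fun i => (Finset.mem_filter.1 (hτ i)).1, rfl⟩
    rw [if_neg hd, ite_self, if_neg hninG']

/-- The top component of the monomial `x^u` (coefficient `1`) is itself. [folklore] -/
theorem topComponent_monomial_one (w : Fin n × Fin n → ℕ) (u : (Fin n × Fin n) →₀ ℕ) :
    topComponent w (monomial u (1 : ℝ≥0)) = monomial u 1 :=
  topComponent_eq_self_of_isWeightedHomogeneous w (isWeightedHomogeneous_monomial w u _ rfl)

/-- **Push-off (rung of `stub_hybridDescent`, exits (i)/(iii)).**  If the sub-face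
`G' = {e ∈ G : e ∉ supp u}` contains a perfect matching, then `L⁺(per_{G'}) ≤ L⁺(x^u · per_G)`:
a monomial cofactor is stripped exactly by passing to the sub-face of `G` avoiding its support.
[folklore] -/
theorem complexity_pushOff_le (G : Finset (Fin n × Fin n)) (u : (Fin n × Fin n) →₀ ℕ)
    (hex : ∃ σ : Equiv.Perm (Fin n), ∀ i, (σ i, i) ∈ G ∧ (σ i, i) ∉ u.support) :
    complexity ((∑ σ ∈ (Finset.univ : Finset (Equiv.Perm (Fin n))).filter (fun σ => ∀ i, (σ i, i) ∈ (G.filter fun e => e ∉ u.support)),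
        monomial (permMonomial σ) (1 : ℝ≥0))) ≤
      complexity (monomial u (1 : ℝ≥0) * (∑ σ ∈ (Finset.univ : Finset (Equiv.Perm (Fin n))).filter (fun σ => ∀ i, (σ i, i) ∈ G),
        monomial (permMonomial σ) (1 : ℝ≥0))) := by
  classical
  set G' : Finset (Fin n × Fin n) := G.filter fun e => e ∉ u.support with hG'
  -- (1) top components: `L(x^u · per_{G'}) ≤ L(x^u · per_G)`
  have h1 : complexity (monomial u (1 : ℝ≥0) * (∑ σ ∈ (Finset.univ : Finset (Equiv.Perm (Fin n))).filter (fun σ => ∀ i, (σ i, i) ∈ G'),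
        monomial (permMonomial σ) (1 : ℝ≥0))) ≤
      complexity (monomial u (1 : ℝ≥0) * (∑ σ ∈ (Finset.univ : Finset (Equiv.Perm (Fin n))).filter (fun σ => ∀ i, (σ i, i) ∈ G),
        monomial (permMonomial σ) (1 : ℝ≥0))) := by
    have h := complexity_topComponent_le ((fun e : Fin n × Fin n => if e ∈ u.support then (0 : ℕ) else 1)) (monomial u (1 : ℝ≥0) * (∑ σ ∈ (Finset.univ : Finset (Equiv.Perm (Fin n))).filter (fun σ => ∀ i, (σ i, i) ∈ G),
        monomial (permMonomial σ) (1 : ℝ≥0)))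
    rwa [topComponent_mul, topComponent_monomial_one, topComponent_facePer_eq G u hex] at h
  -- (2) the projection onto `(supp u)ᶜ` kills `x^u` and fixes `per_{G'}`
  set S : Finset (Fin n × Fin n) := Finset.univ.filter fun e => e ∉ u.support with hS
  have hprjG : aeval (fun e => if e ∈ S then (X e : MvPolynomial (Fin n × Fin n) ℝ≥0) else 1)
      ((∑ σ ∈ (Finset.univ : Finset (Equiv.Perm (Fin n))).filter (fun σ => ∀ i, (σ i, i) ∈ G'),
        monomial (permMonomial σ) (1 : ℝ≥0))) = (∑ σ ∈ (Finset.univ : Finset (Equiv.Perm (Fin n))).filter (fun σ => ∀ i, (σ i, i) ∈ G'),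
        monomial (permMonomial σ) (1 : ℝ≥0)) := by
    rw [map_sum]
    refine Finset.sum_congr rfl fun σ hσ => ?_
    refine aeval_proj_monomial S ?_ (fun e _ => rfl) 1
    intro e he
    have heG' := support_permMonomial_subset (Finset.mem_filter.1 hσ).2 he
    exact Finset.mem_filter.2 ⟨Finset.mem_univ e, (Finset.mem_filter.1 heG').2⟩
  have hprjU : aeval (fun e => if e ∈ S then (X e : MvPolynomial (Fin n × Fin n) ℝ≥0) else 1)
      (monomial u (1 : ℝ≥0)) = 1 := by
    have h0 : (0 : (Fin n × Fin n) →₀ ℕ).support ⊆ S := by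
      rw [Finsupp.support_zero]
      exact Finset.empty_subset _
    have hagree : ∀ e ∈ S, u e = (0 : (Fin n × Fin n) →₀ ℕ) e := by
      intro e he
      have hne : e ∉ u.support := (Finset.mem_filter.1 he).2
      rw [Finsupp.notMem_support_iff.1 hne, Finsupp.zero_apply]
    rw [aeval_proj_monomial S h0 hagree (1 : ℝ≥0), monomial_zero', C_1]
  have hproj : IsProjection ((∑ σ ∈ (Finset.univ : Finset (Equiv.Perm (Fin n))).filter (fun σ => ∀ i, (σ i, i) ∈ G'),
        monomial (permMonomial σ) (1 : ℝ≥0))) (monomial u (1 : ℝ≥0) * (∑ σ ∈ (Finset.univ : Finset (Equiv.Perm (Fin n))).filter (fun σ => ∀ i, (σ i, i) ∈ G'),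
        monomial (permMonomial σ) (1 : ℝ≥0))) := by
    refine ⟨fun e => if e ∈ S then X e else 1, fun e => ?_, ?_⟩
    · by_cases he : e ∈ S
      · exact Or.inl ⟨e, if_pos he⟩
      · refine Or.inr ⟨1, ?_⟩
        show (if e ∈ S then X e else 1) = C 1
        rw [if_neg he, C_1]
    · rw [map_mul, hprjG, hprjU, one_mul]
  have h2 : complexity ((∑ σ ∈ (Finset.univ : Finset (Equiv.Perm (Fin n))).filter (fun σ => ∀ i, (σ i, i) ∈ G'),
        monomial (permMonomial σ) (1 : ℝ≥0))) ≤ complexity (monomial u (1 : ℝ≥0) * (∑ σ ∈ (Finset.univ : Finset (Equiv.Perm (Fin n))).filter (fun σ => ∀ i, (σ i, i) ∈ G'),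
        monomial (permMonomial σ) (1 : ℝ≥0))) :=
    IsProjection.complexity_le_holds hproj
  exact h2.trans h1

/-- **Support avoidance** (the case `u = 0` needs no monomial at all): for EVERY nonzero
multiplier `h` whose monomials avoid a graph `G` containing a perfect matching,
`L⁺(per_G) ≤ L⁺(per_n · h) + 1` — restate of `FaceDescent.stub_faceDescent` with the weight `1_G`
and the `G`-part `u = 0`. [folklore] -/
theorem complexity_facePer_le_of_avoid (G : Finset (Fin n × Fin n))
    (h : MvPolynomial (Fin n × Fin n) ℝ≥0) (hh : h ≠ 0)
    (hG : ∃ σ : Equiv.Perm (Fin n), ∀ i, (σ i, i) ∈ G)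
    (havoid : ∀ m ∈ h.support, ∀ e ∈ G, m e = 0) :
    complexity ((∑ σ ∈ (Finset.univ : Finset (Equiv.Perm (Fin n))).filter (fun σ => ∀ i, (σ i, i) ∈ G),
        monomial (permMonomial σ) (1 : ℝ≥0))) ≤ complexity (perPoly (Fin n) ℝ≥0 * h) + 1 := by
  classical
  -- the weight `1_G` cuts out `G`
  set w : Fin n × Fin n → ℕ := fun e => if e ∈ G then 1 else 0 with hw
  have hcut : ∀ σ : Equiv.Perm (Fin n),
      (∀ i, (σ i, i) ∈ G) ↔ ∀ τ : Equiv.Perm (Fin n), (∑ i, w (τ i, i)) ≤ ∑ i, w (σ i, i) := by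
    obtain ⟨σ₀, hσ₀⟩ := hG
    have hle : ∀ τ : Equiv.Perm (Fin n), ∑ i, w (τ i, i) ≤ n := fun τ =>
      calc ∑ i, w (τ i, i) ≤ ∑ _i : Fin n, 1 :=
            Finset.sum_le_sum fun i _ => by simp only [hw]; split_ifs <;> omega
        _ = n := by simp
    have heq : ∀ τ : Equiv.Perm (Fin n), (∀ i, (τ i, i) ∈ G) ↔ ∑ i, w (τ i, i) = n := by
      intro τ
      constructor
      · intro hτ
        calc ∑ i, w (τ i, i) = ∑ _i : Fin n, 1 :=
              Finset.sum_congr rfl fun i _ => by simp only [hw]; rw [if_pos (hτ i)]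
          _ = n := by simp
      · intro hsum i
        by_contra hi
        have hlt : ∑ j, w (τ j, j) < ∑ _j : Fin n, 1 := by
          refine Finset.sum_lt_sum (fun j _ => by simp only [hw]; split_ifs <;> omega)
            ⟨i, Finset.mem_univ i, ?_⟩
          simp only [hw]
          rw [if_neg hi]
          exact zero_lt_one
        simp at hlt
        omega
    intro σ
    rw [heq σ]
    constructor
    · intro hσ τ
      rw [hσ]
      exact hle τ
    · intro hmax
      have hm := hmax σ₀
      rw [(heq σ₀).1 hσ₀] at hm
      exact le_antisymm (hle σ) hm
  -- every monomial of `h` has `w`-weight `0`, so `top_w h = h`, with single `G`-part `0`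
  have hhom : IsWeightedHomogeneous w h 0 := by
    intro m hm
    rw [Finsupp.weight_apply, Finsupp.sum]
    refine Finset.sum_eq_zero fun e he => ?_
    by_cases heG : e ∈ G
    · rw [havoid m (mem_support_iff.2 hm) e heG, zero_smul]
    · simp only [hw]
      rw [if_neg heG, smul_zero]
  have htop : topComponent w h = h := topComponent_eq_self_of_isWeightedHomogeneous w hhom
  have hpart : (0 : (Fin n × Fin n) →₀ ℕ).support ⊆ G ∧
      ∀ m ∈ (topComponent w h).support, ∀ e ∈ G, m e = (0 : (Fin n × Fin n) →₀ ℕ) e := by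
    refine ⟨by simp, fun m hm e he => ?_⟩
    rw [htop] at hm
    rw [havoid m hm e he]
    rfl
  have h := stub_faceDescent n G w h 0 hcut hh hpart
  rwa [monomial_zero', C_1, one_mul] at h

/-- **Registered form (sub-goal `stub_pushOff` of the open core `stub_hybridDescent`).**  For every
face `G` and exponent `u` whose avoidance sub-face `{e ∈ G : e ∉ supp u}` contains a perfect matching,
`L⁺(per_{G ∖ supp u}) ≤ L⁺(x^u · per_G)`. [folklore] -/
theorem stub_pushOff :
    ∀ (n : ℕ) (G : Finset (Fin n × Fin n)) (u : (Fin n × Fin n) →₀ ℕ),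
      (∃ σ : Equiv.Perm (Fin n), ∀ i, (σ i, i) ∈ G ∧ (σ i, i) ∉ u.support) →
      Literature.Computability.AlgebraicComplexity.complexity
          (∑ σ ∈ (Finset.univ : Finset (Equiv.Perm (Fin n))).filter
              (fun σ => ∀ i, (σ i, i) ∈ G.filter fun e => e ∉ u.support),
            MvPolynomial.monomial (Literature.Computability.AlgebraicComplexity.permMonomial σ) (1 : NNReal)) ≤
        Literature.Computability.AlgebraicComplexity.complexity
          (MvPolynomial.monomial u (1 : NNReal) *
            ∑ σ ∈ (Finset.univ : Finset (Equiv.Perm (Fin n))).filter (fun σ => ∀ i, (σ i, i) ∈ G),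
              MvPolynomial.monomial (Literature.Computability.AlgebraicComplexity.permMonomial σ) (1 : NNReal)) :=
  fun _ G u hex => complexity_pushOff_le G u hex

end Summit.ValiantsHypothesis.ValiantsHypothesis.Theorems.DivisionGap.PerMultiplesHard.PushOff

end
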